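import Summits.BirchSwinnertonDyer.BirchSwinnertonDyer.Theorems.AlignedTransportAtTwoMainConjectureOfRankZeroBSDAtTwoCubicKilfordPrimes
import Mathlib.NumberTheory.Padics.RingHoms
import HarnessLib

/-!
# Route `AlignedTransportAtTwo`, crux C2 `MainConjectureOfRankZeroBSDAtTwo` (stmt-BirchSwinnertonDyer-22298):
# THE DICTIONARY'S OTHER HALF — a prime of `𝓞 F` above `p` with `e = f = 1` IS an embedding `F → ℚ_p`; hence OFF the Kilford stratum
# (`Δ_min ≢ 1 (mod 8)`) the cubic `2`-torsion field has AT MOST TWO primes above `2`, and the number of primes above `2` is decided by `Δ_min mod 8`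

HONEST FRAMING (cell `bsd-f1-sign2`, WIDTH-5 attached prover seat `bsd-line-att-p5` gen 26 on line `birth` of the lead `bsd-line-att-p2`;
`--supports` stmt-BirchSwinnertonDyer-22298, closes nothing; BSD is NOT proved by any of this; the crux C2, its verdict «blocked-on
`Rank1Residual.GreenbergMuConjectureIrreducible`» and every registered stub are untouched). THEOREMS ONLY — no definition, no named fact,
no `sorry`. Companion of this gen's `…CubicKilfordPrimes` (ON the stratum ⟹ three primes above `2`): together, the NUMBER of primes of `ℚ(e₁)`
above `2` is a kernel function of `Δ_min mod 8` on the good-ordinary seed cell — what cell bsd-2adic's layer-`(0,1)` Chevalley door («at most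
two primes above `2`») and this seat's layer-`(n,n+1)` doors («three primes») display. att-p4 g11's recorded gap («a kernel proof needs
completions of `F` at `v ∣ 2` — not attempted») is closed in the form actually used, WITHOUT completions as objects: `ℤ_p = lim ℤ/pⁿ`
(Mathlib `PadicInt.lift`).

WHAT.
* §1 **`exists_ringHom_padic_of_ramificationIdx_eq_one_of_inertiaDeg_eq_one`** (any number field `F`, any prime `p`): a height-one prime `w ∋ p`
  of `𝓞 F` with `e(w|p) = f(w|p) = 1` yields `σ : F → ℚ_p` with `w = {r ∈ 𝓞 F : ‖σ r‖_p < 1}`. Mechanism: `e = 1` gives `(m : 𝓞 F) ∈ wⁿ ⟺ pⁿ ∣ m`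
  (`natCast_mem_pow_iff_of_ramificationIdx_eq_one`, `v_w(p) = exp(−e)`), so `𝓞 F / wⁿ` has characteristic `pⁿ`; `f = 1` gives
  `#(𝓞 F / wⁿ) = N(w)ⁿ = pⁿ` (`natCard_quotient_pow_of_inertiaDeg_eq_one`); hence `ℤ/pⁿ ≃ 𝓞 F / wⁿ` (`ZMod.ringEquiv`), the inverses are a
  compatible family (ring maps out of `ℤ/pⁿ` are unique), `PadicInt.lift` gives `𝓞 F → ℤ_p`, injective by Krull (`⋂ wⁿ = 0`), extended to `F`.
* §2 (cubic fields) `inertiaDeg_eq_one_of_three_le_ncard`; **`onKilfordStratumAtTwo_of_three_le_ncard`** — `V/ℚ` with `E_V(ℚ)[2] = 0`, `F` a cubic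
  field with a root `e₁` of `c_V`, THREE primes above `2` in `F` ⟹ `V` ON the Kilford stratum (NO reduction hypothesis: three embeddings ⟹ three
  distinct `ℚ₂`-roots of the cubic `c_V` ⟹ it splits); **`ncard_le_two_of_not_onKilfordStratumAtTwo`**; the decidable form
  **`ncard_le_two_of_minimalDiscriminantInt_emod_eight_ne_one`**; THE DICTIONARY both ways **`three_le_ncard_iff_onKilfordStratumAtTwo`** /
  **`three_le_ncard_iff_minimalDiscriminantInt_emod_eight`** (good ordinary `V`, `E_V(ℚ)[2] = 0`: `3` primes iff `Δ_min ≡ 1 (mod 8)`).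
* §3 the `ℚ(β)` currency (`β` a root of `4x³ + b₂x² + 2b₄x + b₆`): **`ncard_adjoin_le_two_of_not_onKilfordStratumAtTwo`** / `…_emod_eight_ne_one` —
  the shape of the hypothesis «at most two primes above `2`» of cell bsd-2adic's Chevalley door.

Nothing is asserted about any seed; nothing is closed; BSD is not proved.

References: [NeukirchANT1999] Ch. II §8 (8.1)–(8.3) (primes above `p` ↔ embeddings; `e = f = 1` ⟺ `F_w = ℚ_p`), Ch. I §8 Prop. (8.2);
[Serre1973] Ch. II §3.3 Thm. 4; [SilvermanAEC2009] III.1, VII.2, VIII.8; F. Q. Gouvêa, *p-adic Numbers* §3.3 (`ℤ_p = lim ℤ/pⁿ`); tree: att-p5 g25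
p743166, g26 `…CubicKilfordPrimes` (p746875), g16 `…PadicLetterOnPointsPrimes`, g14 `…AlignedTransportAtTwoBridge`, `…KilfordStratumShared`.
-/

set_option linter.dupNamespace false
set_option autoImplicit false

noncomputable section

open scoped Classical NumberField nonZeroDivisors

namespace Summit.BirchSwinnertonDyer.BirchSwinnertonDyer.Theorems.AlignedTransportAtTwoCubicOffStratumPrimes

open NumberField IsDedekindDomain Polynomial WeierstrassCurve IntermediateField
  Literature.NumberTheory.EllipticCurves Literature.NumberTheory.EllipticCurves.Greenberg1999
  Summit.BirchSwinnertonDyer.Rank1Residual.F1Sign2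
  Summit.BirchSwinnertonDyer.BirchSwinnertonDyer.Theorems.AlignedTransportAtTwoBridge
  Summit.BirchSwinnertonDyer.BirchSwinnertonDyer.Theorems.AlignedTransportAtTwoFineRoad.RealKummerLinesPadicLetterOnPointsPrimes
  Summit.BirchSwinnertonDyer.BirchSwinnertonDyer.Theorems.AlignedTransportAtTwoKilfordStratumShared
  Summit.BirchSwinnertonDyer.BirchSwinnertonDyer.Theorems.AlignedTransportAtTwoCubicLayerOneDoors
  Summit.BirchSwinnertonDyer.BirchSwinnertonDyer.Theorems.AlignedTransportAtTwoCubicKilfordPrimes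

/-! ## §1 A prime with `e = f = 1` is an embedding into `ℚ_p` -/

section DegreeOne

variable {F : Type*} [Field F] [NumberField F] {p : ℕ} [Fact p.Prime]

/-- **`(m : 𝓞 F) ∈ wⁿ ⟺ pⁿ ∣ m` for a prime `w ∋ p` of ramification index `e(w|p) = 1`** (`v_w(p) = e = 1`, `v_w(u) = 0` for `p ∤ u`).
[cite: NeukirchANT1999, Ch. I §8 Prop. (8.2) and Ch. II §8 (8.2)] -/
theorem natCast_mem_pow_iff_of_ramificationIdx_eq_one (w : HeightOneSpectrum (𝓞 F)) (hpw : (p : 𝓞 F) ∈ w.asIdeal)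
    (he : w.asIdeal.ramificationIdx ℤ = 1) (m n : ℕ) :
    (m : 𝓞 F) ∈ w.asIdeal ^ n ↔ p ^ n ∣ m := by
  classical
  have hp : p.Prime := Fact.out
  haveI := liesOver_span_of_natCast_mem p w hpw
  constructor
  · intro hm
    rcases Nat.eq_zero_or_pos m with rfl | hm0
    · exact dvd_zero _
    obtain ⟨k, u, hu, rfl⟩ := Nat.exists_eq_pow_mul_and_not_dvd hm0.ne' p hp.ne_one
    -- `v_w(p) = exp(-1)`
    have hmap : (Ideal.span {(p : ℤ)}).map (algebraMap ℤ (𝓞 F)) = Ideal.span {(p : 𝓞 F)} := by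
      rw [Ideal.map_span, Set.image_singleton, map_natCast]
    have hmap0 : (Ideal.span {(p : ℤ)}).map (algebraMap ℤ (𝓞 F)) ≠ ⊥ := by
      rw [hmap, Ne, Ideal.span_singleton_eq_bot]; exact_mod_cast hp.ne_zero
    have hvp : w.intValuation (p : 𝓞 F) = WithZero.exp (-(1 : ℤ)) := by
      rw [HeightOneSpectrum.intValuation_eq_exp_neg_multiplicity _ (by exact_mod_cast hp.ne_zero), ← hmap,
        ← Ideal.IsDedekindDomain.ramificationIdx_eq_multiplicity (Ideal.span {(p : ℤ)}) w.asIdeal hmap0, he, Nat.cast_one]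
    -- `v_w(u) = 1` for `p ∤ u`
    have hvu : w.intValuation (u : 𝓞 F) = 1 := by
      rw [HeightOneSpectrum.intValuation_eq_one_iff]
      intro huw
      apply hu
      have h1 : (algebraMap ℤ (𝓞 F)) (u : ℤ) ∈ w.asIdeal := by rwa [map_natCast]
      have h2 : ((u : ℕ) : ℤ) ∈ w.asIdeal.under ℤ := Ideal.mem_comap.mpr h1
      rw [← Ideal.LiesOver.over (p := Ideal.span {(p : ℤ)}) (P := w.asIdeal), Ideal.mem_span_singleton] at h2
      exact_mod_cast h2
    have hval : w.intValuation ((p ^ k * u : ℕ) : 𝓞 F) = WithZero.exp (-(k : ℤ)) := by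
      push_cast
      rw [map_mul, map_pow, hvp, hvu, mul_one, ← WithZero.exp_nsmul, smul_neg, nsmul_one]
    have hle := (HeightOneSpectrum.intValuation_le_pow_iff_mem w _ n).mpr hm
    rw [hval, WithZero.exp_le_exp, neg_le_neg_iff, Int.ofNat_le] at hle
    exact Dvd.dvd.mul_right (pow_dvd_pow p hle) u
  · rintro ⟨c, rfl⟩
    push_cast
    exact Ideal.mul_mem_right _ _ (Ideal.pow_mem_pow hpw n)

/-- **`#(𝓞 F / wⁿ) = pⁿ` for a prime `w ∋ p` of residue degree `f(w|p) = 1`** (`N(wⁿ) = N(w)ⁿ = (p^f)ⁿ`).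
[cite: NeukirchANT1999, Ch. I §8 Prop. (8.2)] -/
theorem natCard_quotient_pow_of_inertiaDeg_eq_one (w : HeightOneSpectrum (𝓞 F)) (hpw : (p : 𝓞 F) ∈ w.asIdeal)
    (hf : w.asIdeal.inertiaDeg ℤ = 1) (n : ℕ) : Nat.card (𝓞 F ⧸ w.asIdeal ^ n) = p ^ n := by
  have hp : p.Prime := Fact.out
  haveI := liesOver_span_of_natCast_mem p w hpw
  haveI : (Ideal.span {(p : ℤ)}).IsMaximal := Int.ideal_span_isMaximal_of_prime p
  haveI : w.asIdeal.IsMaximal := w.isMaximal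
  rw [← Submodule.cardQuot_apply, ← Ideal.absNorm_apply, map_pow, Ideal.absNorm_eq_pow_inertiaDeg' w.asIdeal hp,
    Ideal.inertiaDeg'_eq_inertiaDeg (Ideal.span {(p : ℤ)}) w.asIdeal, hf, pow_one]

/-- **A PRIME WITH `e = f = 1` IS AN EMBEDDING INTO `ℚ_p`.** For a number field `F`, a prime `p` and a height-one prime `w ∋ p` of `𝓞 F` with
ramification index `e(w|p) = 1` and residue degree `f(w|p) = 1`, there is a ring map `σ : F → ℚ_p` whose «valuation ideal» on `𝓞 F` is
exactly `w`: `r ∈ w ⟺ ‖σ r‖_p < 1` for `r ∈ 𝓞 F` (so `w` is the prime cut out by `σ` in the sense of `…AlignedTransportAtTwoBridge`). Construction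
WITHOUT completions: `ℤ/pⁿ ≃ 𝓞 F/wⁿ` for every `n` (characteristic `pⁿ` by `natCast_mem_pow_iff_of_ramificationIdx_eq_one`, cardinality `pⁿ` by
`natCard_quotient_pow_of_inertiaDeg_eq_one`), the inverses form a compatible family (ring maps out of `ℤ/pⁿ` are unique), `PadicInt.lift` assembles
`𝓞 F → ℤ_p = lim ℤ/pⁿ`, injective by Krull's intersection theorem, extended to `F = Frac 𝓞 F`. (Neukirch: `F_w = ℚ_p` iff `e = f = 1`.)
[cite: NeukirchANT1999, Ch. II §8, (8.1)–(8.3)] -/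
theorem exists_ringHom_padic_of_ramificationIdx_eq_one_of_inertiaDeg_eq_one (w : HeightOneSpectrum (𝓞 F))
    (hpw : (p : 𝓞 F) ∈ w.asIdeal) (he : w.asIdeal.ramificationIdx ℤ = 1) (hf : w.asIdeal.inertiaDeg ℤ = 1) :
    ∃ σ : F →+* ℚ_[p], ∀ r : 𝓞 F, r ∈ w.asIdeal ↔ ‖σ (algebraMap (𝓞 F) F r)‖ < 1 := by
  classical
  have hp : p.Prime := Fact.out
  -- the quotients `𝓞 F / wⁿ` are `ℤ/pⁿ`
  have hfin : ∀ n : ℕ, Finite (𝓞 F ⧸ w.asIdeal ^ n) := fun n =>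
    Ideal.finiteQuotientOfFreeOfNeBot _ (pow_ne_zero n w.ne_bot)
  have hchar : ∀ n : ℕ, CharP (𝓞 F ⧸ w.asIdeal ^ n) (p ^ n) := fun n =>
    ⟨fun x => by
      rw [← map_natCast (Ideal.Quotient.mk (w.asIdeal ^ n)), Ideal.Quotient.eq_zero_iff_mem,
        natCast_mem_pow_iff_of_ramificationIdx_eq_one w hpw he x n]⟩
  have ι : ∀ n : ℕ, ZMod (p ^ n) ≃+* 𝓞 F ⧸ w.asIdeal ^ n := fun n => by
    haveI := hfin n
    haveI := hchar n
    letI : Fintype (𝓞 F ⧸ w.asIdeal ^ n) := Fintype.ofFinite _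
    exact ZMod.ringEquiv _ (by rw [Fintype.card_eq_nat_card, natCard_quotient_pow_of_inertiaDeg_eq_one w hpw hf n])
  -- the compatible family `𝓞 F → ℤ/pⁿ`
  let f : ∀ k : ℕ, 𝓞 F →+* ZMod (p ^ k) := fun k => (ι k).symm.toRingHom.comp (Ideal.Quotient.mk (w.asIdeal ^ k))
  have hfapp : ∀ k (r : 𝓞 F), f k r = (ι k).symm (Ideal.Quotient.mk (w.asIdeal ^ k) r) := fun k r => rfl
  have f_compat : ∀ (k1 k2 : ℕ) (hk : k1 ≤ k2), (ZMod.castHom (pow_dvd_pow p hk) (ZMod (p ^ k1))).comp (f k2) = f k1 := by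
    intro k1 k2 hk
    have hle : w.asIdeal ^ k2 ≤ w.asIdeal ^ k1 := Ideal.pow_le_pow_right hk
    set g₁ : 𝓞 F ⧸ w.asIdeal ^ k2 →+* ZMod (p ^ k1) := (ZMod.castHom (pow_dvd_pow p hk) (ZMod (p ^ k1))).comp (ι k2).symm.toRingHom
      with hg₁
    set g₂ : 𝓞 F ⧸ w.asIdeal ^ k2 →+* ZMod (p ^ k1) := (ι k1).symm.toRingHom.comp (Ideal.Quotient.factor hle) with hg₂
    have hg : g₁ = g₂ := by
      have hc : g₁.comp (ι k2).toRingHom = g₂.comp (ι k2).toRingHom := Subsingleton.elim _ _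
      refine RingHom.ext fun y => ?_
      obtain ⟨z, rfl⟩ := (ι k2).surjective y
      exact RingHom.congr_fun hc z
    refine RingHom.ext fun r => ?_
    have h := RingHom.congr_fun hg (Ideal.Quotient.mk (w.asIdeal ^ k2) r)
    simp only [hg₁, hg₂, RingHom.coe_comp, Function.comp_apply, RingEquiv.toRingHom_eq_coe, RingHom.coe_coe,
      Ideal.Quotient.factor_mk] at h
    simp only [RingHom.coe_comp, Function.comp_apply, hfapp]
    exact h
  -- the lift `ψ : 𝓞 F → ℤ_p`
  let ψ : 𝓞 F →+* ℤ_[p] := PadicInt.lift f_compat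
  have hψ : ∀ (n : ℕ) (r : 𝓞 F), PadicInt.toZModPow n (ψ r) = f n r := fun n r =>
    RingHom.congr_fun (PadicInt.lift_spec f_compat n) r
  -- `f n r = 0 ↔ r ∈ wⁿ`
  have hf0 : ∀ (n : ℕ) (r : 𝓞 F), f n r = 0 ↔ r ∈ w.asIdeal ^ n := fun n r => by
    rw [hfapp, EmbeddingLike.map_eq_zero_iff, Ideal.Quotient.eq_zero_iff_mem]
  -- (i)/(ii): `r ∈ w ↔ p ∣ ψ r`
  have hdvd : ∀ r : 𝓞 F, r ∈ w.asIdeal ↔ (p : ℤ_[p]) ∣ ψ r := fun r => by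
    rw [← pow_one w.asIdeal, ← hf0 1 r, ← hψ 1 r, ← RingHom.mem_ker, PadicInt.ker_toZModPow, Ideal.mem_span_singleton, pow_one]
  -- (iii): `ψ` is injective (Krull: `⋂ wⁿ = 0`)
  have hinjψ : Function.Injective ψ := by
    rw [injective_iff_map_eq_zero]
    intro r hr
    have hmem : r ∈ ⨅ n : ℕ, w.asIdeal ^ n := by
      refine Ideal.mem_iInf.mpr fun n => (hf0 n r).mp ?_
      rw [← hψ n r, hr, map_zero]
    rwa [Ideal.iInf_pow_eq_bot_of_isDomain w.asIdeal w.isPrime.ne_top, Ideal.mem_bot] at hmem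
  -- extend to `F`
  have hinj : Function.Injective ((PadicInt.Coe.ringHom (p := p)).comp ψ) :=
    (show Function.Injective (PadicInt.Coe.ringHom (p := p)) from Subtype.val_injective).comp hinjψ
  refine ⟨IsFractionRing.lift hinj, fun r => ?_⟩
  rw [IsFractionRing.lift_algebraMap hinj, RingHom.comp_apply, hdvd r]
  change (p : ℤ_[p]) ∣ ψ r ↔ ‖((ψ r : ℤ_[p]) : ℚ_[p])‖ < 1
  rw [← PadicInt.norm_lt_one_iff_dvd]
  rfl

end DegreeOne

/-! ## §2 Cubic fields: three primes above `2` ⟹ ON the Kilford stratum; OFF the stratum ⟹ at most two -/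

section Cubic

variable (F : Type) [Field F] [NumberField F]

/-- **Three primes above `2` in a cubic field ⟹ each has residue degree `1`** (`Σ eᵢ fᵢ = 3` over at least three primes forces
`eᵢ = fᵢ = 1`; companion of `AlignedTransportAtTwoCubicLayerOneDoors.ramificationIdx_eq_one_of_three_le_ncard`).
[cite: NeukirchANT1999, Ch. I §8, Prop. (8.2)] -/
theorem inertiaDeg_eq_one_of_three_le_ncard (hF : Module.finrank ℚ F = 3)
    (h3 : 3 ≤ {v : HeightOneSpectrum (𝓞 F) | ((2 : ℕ) : 𝓞 F) ∈ v.asIdeal}.ncard)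
    (w : HeightOneSpectrum (𝓞 F)) (hw : ((2 : ℕ) : 𝓞 F) ∈ w.asIdeal) : w.asIdeal.inertiaDeg ℤ = 1 := by
  classical
  haveI : (Ideal.span {(2 : ℤ)}).IsMaximal :=
    Ideal.IsPrime.isMaximal ((Ideal.span_singleton_prime two_ne_zero).mpr Int.prime_two) (by simp)
  have h20 : (Ideal.span {(2 : ℤ)} : Ideal ℤ) ≠ ⊥ := by simp
  have hmem : ∀ v : HeightOneSpectrum (𝓞 F), ((2 : ℕ) : 𝓞 F) ∈ v.asIdeal →
      v.asIdeal ∈ IsDedekindDomain.primesOverFinset (Ideal.span {(2 : ℤ)}) (𝓞 F) := by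
    intro v hv
    haveI : v.asIdeal.IsPrime := v.isPrime
    have hv2 : (2 : 𝓞 F) ∈ v.asIdeal := by exact_mod_cast hv
    have hvl : v.asIdeal.LiesOver (Ideal.span {(2 : ℤ)}) := by
      rw [Ideal.liesOver_span_iff v.isPrime.ne_top Int.prime_two, map_ofNat]; exact hv2
    exact (IsDedekindDomain.mem_primesOverFinset_iff h20 _).mpr ⟨v.isPrime, hvl⟩
  set S := IsDedekindDomain.primesOverFinset (Ideal.span {(2 : ℤ)}) (𝓞 F) with hSdef
  have hS3 : 3 ≤ S.card := by
    have hinj : Set.InjOn (fun v : HeightOneSpectrum (𝓞 F) => v.asIdeal)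
        {v : HeightOneSpectrum (𝓞 F) | ((2 : ℕ) : 𝓞 F) ∈ v.asIdeal} :=
      fun v _ v' _ h => HeightOneSpectrum.ext h
    have hle := Set.ncard_le_ncard_of_injOn (fun v : HeightOneSpectrum (𝓞 F) => v.asIdeal) (fun v hv => ?_) hinj
      (t := (S : Set (Ideal (𝓞 F)))) (Finset.finite_toSet S)
    · rw [Set.ncard_coe_finset] at hle
      exact h3.trans hle
    · exact hmem v hv
  have hsum := Ideal.sum_ramification_inertia (R := ℤ) (𝓞 F) ℚ F (p := Ideal.span {(2 : ℤ)}) h20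
  rw [hF] at hsum
  have hwS : w.asIdeal ∈ S := hmem w hw
  haveI : w.asIdeal.IsPrime := w.isPrime
  haveI : w.asIdeal.IsMaximal := w.isMaximal
  haveI hwl : w.asIdeal.LiesOver (Ideal.span {(2 : ℤ)}) := by
    have hw2 : (2 : 𝓞 F) ∈ w.asIdeal := by exact_mod_cast hw
    rw [Ideal.liesOver_span_iff w.isPrime.ne_top Int.prime_two, map_ofNat]; exact hw2
  have hpos : ∀ P ∈ S, 1 ≤ Ideal.ramificationIdx' (Ideal.span {(2 : ℤ)}) P * Ideal.inertiaDeg' (Ideal.span {(2 : ℤ)}) P := by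
    intro P hP
    obtain ⟨hPp, hPl⟩ := (IsDedekindDomain.mem_primesOverFinset_iff h20 _).mp hP
    haveI := hPp
    haveI := hPl
    have he : Ideal.ramificationIdx' (Ideal.span {(2 : ℤ)}) P ≠ 0 := Ideal.Factors.ramificationIdx_ne_zero (Ideal.span {(2 : ℤ)}) ⟨P, hP⟩
    have hf : 0 < Ideal.inertiaDeg' (Ideal.span {(2 : ℤ)}) P := Ideal.inertiaDeg'_pos _ P
    exact Nat.one_le_iff_ne_zero.mpr (mul_ne_zero he hf.ne')
  have hsplit := Finset.add_sum_erase S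
    (fun P => Ideal.ramificationIdx' (Ideal.span {(2 : ℤ)}) P * Ideal.inertiaDeg' (Ideal.span {(2 : ℤ)}) P) hwS
  have hrest : (S.erase w.asIdeal).card ≤
      ∑ P ∈ S.erase w.asIdeal, Ideal.ramificationIdx' (Ideal.span {(2 : ℤ)}) P * Ideal.inertiaDeg' (Ideal.span {(2 : ℤ)}) P := by
    rw [Finset.card_eq_sum_ones]
    exact Finset.sum_le_sum fun P hP => hpos P (Finset.mem_of_mem_erase hP)
  have hcard : (S.erase w.asIdeal).card = S.card - 1 := Finset.card_erase_of_mem hwS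
  have htot : Ideal.ramificationIdx' (Ideal.span {(2 : ℤ)}) w.asIdeal * Ideal.inertiaDeg' (Ideal.span {(2 : ℤ)}) w.asIdeal +
      ∑ P ∈ S.erase w.asIdeal, Ideal.ramificationIdx' (Ideal.span {(2 : ℤ)}) P * Ideal.inertiaDeg' (Ideal.span {(2 : ℤ)}) P = 3 :=
    hsplit.trans hsum
  have hew : Ideal.ramificationIdx' (Ideal.span {(2 : ℤ)}) w.asIdeal * Ideal.inertiaDeg' (Ideal.span {(2 : ℤ)}) w.asIdeal ≤ 1 := by
    omega
  have he1 : 1 ≤ Ideal.ramificationIdx' (Ideal.span {(2 : ℤ)}) w.asIdeal :=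
    Nat.one_le_iff_ne_zero.mpr (Ideal.Factors.ramificationIdx_ne_zero (Ideal.span {(2 : ℤ)}) ⟨w.asIdeal, hwS⟩)
  rw [← Ideal.inertiaDeg'_eq_inertiaDeg (Ideal.span {(2 : ℤ)}) w.asIdeal]
  have hf1 : 1 ≤ Ideal.inertiaDeg' (Ideal.span {(2 : ℤ)}) w.asIdeal := Ideal.inertiaDeg'_pos _ _
  have hf2 : Ideal.inertiaDeg' (Ideal.span {(2 : ℤ)}) w.asIdeal ≤ 1 :=
    le_trans (Nat.le_mul_of_pos_left _ he1) hew
  omega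

variable (V : WeierstrassCurve ℚ)

/-- **THREE PRIMES ABOVE `2` IN THE CUBIC FIELD ⟹ ON THE KILFORD STRATUM** (no reduction hypothesis). `V/ℚ` with no rational `2`-torsion
abscissa, `F` a cubic number field with a root `e₁` of the `u`-cubic `c_V = X³ + b₂X² + 8b₄X + 16b₆`; if `𝓞 F` has at least three height-one
primes containing `2`, then `c_V` splits over `ℚ₂`: each of three such primes has `e = f = 1` (`Σ eᵢfᵢ = 3`), hence is an embedding `F → ℚ₂`
(§1), the three embeddings differ at `e₁` (they cut out different primes and `F = ℚ(e₁)`), so `c_V` has three distinct roots in `ℚ₂`.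
[cite: NeukirchANT1999, Ch. II §8, (8.1)–(8.3)] [cite: SilvermanAEC2009, VII.2] -/
theorem onKilfordStratumAtTwo_of_three_le_ncard (ht : ∀ x : ℚ, ¬ HasRationalTwoTorsionX V x)
    (hF : Module.finrank ℚ F = 3) {e₁ : F} (he₁ : aeval e₁ (twoDivisionUCubic V) = 0)
    (h3 : 3 ≤ {v : HeightOneSpectrum (𝓞 F) | ((2 : ℕ) : 𝓞 F) ∈ v.asIdeal}.ncard) : OnKilfordStratumAtTwo V := by
  classical
  -- three distinct primes above `2`, each with `e = f = 1`
  have hfin : {v : HeightOneSpectrum (𝓞 F) | ((2 : ℕ) : 𝓞 F) ∈ v.asIdeal}.Finite := by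
    have h := Ideal.finite_factors (I := Ideal.span {((2 : ℕ) : 𝓞 F)}) (by
      rw [Ne, Submodule.zero_eq_bot, Ideal.span_singleton_eq_bot]; exact_mod_cast (two_ne_zero : (2 : 𝓞 F) ≠ 0))
    exact h.subset fun v hv => (Ideal.dvd_span_singleton).mpr hv
  obtain ⟨w₁, w₂, w₃, hw₁, hw₂, hw₃, h12, h13, h23⟩ :=
    (Set.two_lt_ncard_iff hfin).mp (by omega : 2 < {v : HeightOneSpectrum (𝓞 F) | ((2 : ℕ) : 𝓞 F) ∈ v.asIdeal}.ncard)
  simp only [Set.mem_setOf_eq] at hw₁ hw₂ hw₃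
  have he : ∀ w : HeightOneSpectrum (𝓞 F), ((2 : ℕ) : 𝓞 F) ∈ w.asIdeal → w.asIdeal.ramificationIdx ℤ = 1 :=
    AlignedTransportAtTwoCubicLayerOneDoors.ramificationIdx_eq_one_of_three_le_ncard F hF h3
  have hf : ∀ w : HeightOneSpectrum (𝓞 F), ((2 : ℕ) : 𝓞 F) ∈ w.asIdeal → w.asIdeal.inertiaDeg ℤ = 1 :=
    inertiaDeg_eq_one_of_three_le_ncard F hF h3
  -- the three embeddings
  obtain ⟨σ₁, hσ₁⟩ := exists_ringHom_padic_of_ramificationIdx_eq_one_of_inertiaDeg_eq_one (p := 2) w₁ hw₁ (he w₁ hw₁) (hf w₁ hw₁)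
  obtain ⟨σ₂, hσ₂⟩ := exists_ringHom_padic_of_ramificationIdx_eq_one_of_inertiaDeg_eq_one (p := 2) w₂ hw₂ (he w₂ hw₂) (hf w₂ hw₂)
  obtain ⟨σ₃, hσ₃⟩ := exists_ringHom_padic_of_ramificationIdx_eq_one_of_inertiaDeg_eq_one (p := 2) w₃ hw₃ (he w₃ hw₃) (hf w₃ hw₃)
  -- the power basis on `e₁`: an embedding is determined by the image of `e₁`, and the prime by the embedding
  have hmin : minpoly ℚ e₁ = twoDivisionUCubic V := minpoly_eq_twoDivisionUCubic V ht he₁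
  obtain ⟨pb, hgen, -⟩ := exists_powerBasis_gen_eq (natDegree_twoDivisionUCubic V) hF hmin
  have hdet : ∀ (σ τ : F →+* ℚ_[2]) (v w : HeightOneSpectrum (𝓞 F)),
      (∀ r : 𝓞 F, r ∈ v.asIdeal ↔ ‖σ (algebraMap (𝓞 F) F r)‖ < 1) →
      (∀ r : 𝓞 F, r ∈ w.asIdeal ↔ ‖τ (algebraMap (𝓞 F) F r)‖ < 1) → σ e₁ = τ e₁ → v = w := by
    intro σ τ v w hv hw hστ
    have heq : σ.toRatAlgHom = τ.toRatAlgHom := pb.algHom_ext (by rw [hgen]; exact hστ)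
    have heq' : ∀ a : F, σ a = τ a := fun a => by
      change σ.toRatAlgHom a = τ.toRatAlgHom a; rw [heq]
    refine HeightOneSpectrum.ext (Ideal.ext fun r => ?_)
    rw [hv r, hw r, heq']
  have hr12 : σ₁ e₁ ≠ σ₂ e₁ := fun h => h12 (hdet σ₁ σ₂ w₁ w₂ hσ₁ hσ₂ h)
  have hr13 : σ₁ e₁ ≠ σ₃ e₁ := fun h => h13 (hdet σ₁ σ₃ w₁ w₃ hσ₁ hσ₃ h)
  have hr23 : σ₂ e₁ ≠ σ₃ e₁ := fun h => h23 (hdet σ₂ σ₃ w₂ w₃ hσ₂ hσ₃ h)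
  -- the three images are roots of the mapped cubic
  set c : ℚ_[2][X] := (twoDivisionUCubic V).map (algebraMap ℚ ℚ_[2]) with hc
  have hc0 : c ≠ 0 := Polynomial.map_ne_zero (monic_twoDivisionUCubic V).ne_zero
  have hroot : ∀ σ : F →+* ℚ_[2], σ e₁ ∈ c.roots := fun σ => by
    rw [mem_roots hc0, IsRoot.def, eval_map, ← aeval_def]
    have h := Polynomial.aeval_algHom_apply σ.toRatAlgHom e₁ (twoDivisionUCubic V)
    rw [he₁, map_zero] at h
    exact h
  -- three distinct roots of a cubic ⟹ it splits
  have hsub : ({σ₁ e₁, σ₂ e₁, σ₃ e₁} : Multiset ℚ_[2]) ≤ c.roots := by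
    refine (Multiset.le_iff_subset ?_).mpr fun x hx => ?_
    · simp [hr12, hr13, hr23]
    · simp only [Multiset.insert_eq_cons, Multiset.mem_cons, Multiset.mem_singleton] at hx
      rcases hx with rfl | rfl | rfl <;> exact hroot _
  have hcard3 : Multiset.card ({σ₁ e₁, σ₂ e₁, σ₃ e₁} : Multiset ℚ_[2]) = 3 := by simp
  have hdeg : c.natDegree = 3 := by rw [hc, natDegree_map, natDegree_twoDivisionUCubic]
  have hle := Multiset.card_le_card hsub
  have hge := Polynomial.card_roots' c
  rw [hcard3] at hle
  rw [hdeg] at hge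
  change c.Splits
  rw [splits_iff_card_roots, hdeg]
  omega

/-- **OFF THE KILFORD STRATUM THE CUBIC FIELD HAS AT MOST TWO PRIMES ABOVE `2`** (contrapositive of
`onKilfordStratumAtTwo_of_three_le_ncard`; no reduction hypothesis). [cite: NeukirchANT1999, Ch. II §8, (8.1)–(8.3)] -/
theorem ncard_le_two_of_not_onKilfordStratumAtTwo (ht : ∀ x : ℚ, ¬ HasRationalTwoTorsionX V x)
    (hF : Module.finrank ℚ F = 3) {e₁ : F} (he₁ : aeval e₁ (twoDivisionUCubic V) = 0) (hs : ¬ OnKilfordStratumAtTwo V) :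
    {v : HeightOneSpectrum (𝓞 F) | ((2 : ℕ) : 𝓞 F) ∈ v.asIdeal}.ncard ≤ 2 := by
  by_contra h
  exact hs (onKilfordStratumAtTwo_of_three_le_ncard F V ht hF he₁ (by omega))

variable [V.IsElliptic] [V.IsGloballyMinimal]

/-- The decidable form for a good-ordinary `V`: `Δ_min(V) % 8 ≠ 1` ⟹ at most two primes above `2` in `F` (tree
`onKilfordStratumAtTwo_iff_minimalDiscriminantInt_emod_eight`). [cite: Serre1973, Ch. II §3.3 Thm. 4] [cite: NeukirchANT1999, Ch. II §8] -/
theorem ncard_le_two_of_minimalDiscriminantInt_emod_eight_ne_one (hord : IsOrdinaryAt V 2) (ht : ∀ x : ℚ, ¬ HasRationalTwoTorsionX V x)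
    (h8 : minimalDiscriminantInt V % 8 ≠ 1) (hF : Module.finrank ℚ F = 3) {e₁ : F} (he₁ : aeval e₁ (twoDivisionUCubic V) = 0) :
    {v : HeightOneSpectrum (𝓞 F) | ((2 : ℕ) : 𝓞 F) ∈ v.asIdeal}.ncard ≤ 2 :=
  ncard_le_two_of_not_onKilfordStratumAtTwo F V ht hF he₁
    ((not_onKilfordStratumAtTwo_iff_minimalDiscriminantInt_emod_eight_ne V hord).mpr h8)

/-- **THE DICTIONARY, KERNEL, BOTH DIRECTIONS.** For `V/ℚ` globally minimal with good ORDINARY reduction at `2` and no rational `2`-torsion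
abscissa, and `F` any cubic number field with a root `e₁` of `c_V`: `F` has (at least, equivalently exactly) three primes above `2` iff `V` is ON
the Kilford stratum (this file's §2 with this gen's `…CubicKilfordPrimes.three_le_ncard_of_onKilfordStratumAtTwo`).
[cite: NeukirchANT1999, Ch. II §8, (8.1)–(8.3)] [cite: SilvermanAEC2009, IV.§3 and VII.2] -/
theorem three_le_ncard_iff_onKilfordStratumAtTwo (hord : IsOrdinaryAt V 2) (ht : ∀ x : ℚ, ¬ HasRationalTwoTorsionX V x)
    (hF : Module.finrank ℚ F = 3) {e₁ : F} (he₁ : aeval e₁ (twoDivisionUCubic V) = 0) :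
    3 ≤ {v : HeightOneSpectrum (𝓞 F) | ((2 : ℕ) : 𝓞 F) ∈ v.asIdeal}.ncard ↔ OnKilfordStratumAtTwo V :=
  ⟨onKilfordStratumAtTwo_of_three_le_ncard F V ht hF he₁, fun hs => three_le_ncard_of_onKilfordStratumAtTwo V hord ht hs hF he₁⟩

/-- **THE DICTIONARY, decidable form**: three primes above `2` in `F` iff `Δ_min(V) ≡ 1 (mod 8)` (good ordinary `V`, `E_V(ℚ)[2] = 0`).
[cite: Serre1973, Ch. II §3.3 Thm. 4] [cite: NeukirchANT1999, Ch. II §8, (8.1)–(8.3)] -/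
theorem three_le_ncard_iff_minimalDiscriminantInt_emod_eight (hord : IsOrdinaryAt V 2) (ht : ∀ x : ℚ, ¬ HasRationalTwoTorsionX V x)
    (hF : Module.finrank ℚ F = 3) {e₁ : F} (he₁ : aeval e₁ (twoDivisionUCubic V) = 0) :
    3 ≤ {v : HeightOneSpectrum (𝓞 F) | ((2 : ℕ) : 𝓞 F) ∈ v.asIdeal}.ncard ↔ minimalDiscriminantInt V % 8 = 1 := by
  rw [three_le_ncard_iff_onKilfordStratumAtTwo F V hord ht hF he₁, onKilfordStratumAtTwo_iff_minimalDiscriminantInt_emod_eight V hord]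

end Cubic

/-! ## §3 The `ℚ(β)` currency (`β` a root of `4x³ + b₂x² + 2b₄x + b₆` in `ℚ̄`, `e₁ = 4β`) -/

section Adjoin

variable (W : WeierstrassCurve ℚ) [W.IsElliptic]

/-- **OFF THE STRATUM, `ℚ(β)` HAS AT MOST TWO PRIMES ABOVE `2`** — the shape of the hypothesis «at most two primes above `2`» of cell
bsd-2adic's Chevalley door, for `W/ℚ` with no rational `2`-torsion abscissa OFF the Kilford stratum and `β` any root of the `2`-division cubic.
[cite: NeukirchANT1999, Ch. II §8, (8.1)–(8.3)] -/
theorem ncard_adjoin_le_two_of_not_onKilfordStratumAtTwo (ht : ∀ x : ℚ, ¬ HasRationalTwoTorsionX W x) (hs : ¬ OnKilfordStratumAtTwo W)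
    {β : AlgebraicClosure ℚ} (hβ : aeval β W.twoTorsionPolynomial.toPoly = 0) :
    {v : HeightOneSpectrum (𝓞 ↥(IntermediateField.adjoin ℚ ({β} : Set (AlgebraicClosure ℚ)))) |
      ((2 : ℕ) : 𝓞 ↥(IntermediateField.adjoin ℚ ({β} : Set (AlgebraicClosure ℚ)))) ∈ v.asIdeal}.ncard ≤ 2 := by
  have hirr := AlignedTransportAtTwoSeed.irr_two_of_forall_not_hasRationalTwoTorsionX W ht
  have hβint : IsIntegral ℚ β := ((AlgebraicClosure.isAlgebraic ℚ).isAlgebraic β).isIntegral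
  haveI : FiniteDimensional ℚ ↥(IntermediateField.adjoin ℚ ({β} : Set (AlgebraicClosure ℚ))) :=
    IntermediateField.adjoin.finiteDimensional hβint
  haveI : NumberField ↥(IntermediateField.adjoin ℚ ({β} : Set (AlgebraicClosure ℚ))) := NumberField.mk
  have h3 : Module.finrank ℚ ↥(IntermediateField.adjoin ℚ ({β} : Set (AlgebraicClosure ℚ))) = 3 :=
    AddKatoTwo.finrank_adjoin_root_twoTorsionPolynomial_eq_three W hirr hβ
  exact ncard_le_two_of_not_onKilfordStratumAtTwo _ W ht h3
    (AlignedTransportAtTwoCubicKilfordPrimes.aeval_four_mul_gen_twoDivisionUCubic W hβ) hs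

variable [W.IsGloballyMinimal]

/-- The decidable form for a good-ordinary `W`: `Δ_min(W) % 8 ≠ 1` ⟹ at most two primes above `2` in `ℚ(β)`.
[cite: Serre1973, Ch. II §3.3 Thm. 4] [cite: NeukirchANT1999, Ch. II §8] -/
theorem ncard_adjoin_le_two_of_minimalDiscriminantInt_emod_eight_ne_one (hord : IsOrdinaryAt W 2)
    (ht : ∀ x : ℚ, ¬ HasRationalTwoTorsionX W x) (h8 : minimalDiscriminantInt W % 8 ≠ 1)
    {β : AlgebraicClosure ℚ} (hβ : aeval β W.twoTorsionPolynomial.toPoly = 0) :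
    {v : HeightOneSpectrum (𝓞 ↥(IntermediateField.adjoin ℚ ({β} : Set (AlgebraicClosure ℚ)))) |
      ((2 : ℕ) : 𝓞 ↥(IntermediateField.adjoin ℚ ({β} : Set (AlgebraicClosure ℚ)))) ∈ v.asIdeal}.ncard ≤ 2 :=
  ncard_adjoin_le_two_of_not_onKilfordStratumAtTwo W ht
    ((not_onKilfordStratumAtTwo_iff_minimalDiscriminantInt_emod_eight_ne W hord).mpr h8) hβ

end Adjoin

end Summit.BirchSwinnertonDyer.BirchSwinnertonDyer.Theorems.AlignedTransportAtTwoCubicOffStratumPrimes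

end
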